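import Summits.QuantumFields.YangMills.Theorems.BalabanUVNodesN11RunGuardIsCouplingFloor

/-!
# DAG node N11 — THE RUN GUARD IS EXACTLY PRINT's p.257 AT THE TOP SCALE: on a run in a window `]0, γ]` with a β-ceiling `B` along it and `B·γ² ≤ 1`, `PartCompat₁₃ θ p n` holds at
# EVERY level `n ≤ K` as soon as the TOP `𝐃_K`-cube fits the torus (`L^K·M·R_K(g_K) ∣ 2L^{m+K}`, i.e. `M·R_K(g_K) ∣ 2L^m`: the physical torus contains one top-scale cube); conversely
# compatibility at `K` is that divisibility — so at full length the guard IS «the physical torus contains a top-scale 𝐃-cube» (no slack)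

HEADER — WORK-UNIT METADATA.  Cell `pub-ymgap`, YM-PLAN Track A (HUMAN RULING D-0062 ∕ D-0149 width seats), seat `pub-ymgap-dag-n11-w4` (g4; WIDTH SEAT 4 of 4 on NODE n11
[B14]), route `BalabanUVNodes` rev 27, deciding item K1⁸ `StabilityBRunRowsAtRecordR13SepCoPH` = stmt-QuantumFields-26907 (helper lane, `--kind proof --supports 26907 --as helper`,
count-neutral).  [III] = [Balaban1988Convergent], [I] = [Balaban1987RG1].  Over this seat's p615408 `…N11RunGuardIsCouplingFloor` (`inv_sq_genSeq_le_top_add_of_betaLe`: the upper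
running w.r.t. `g_K`), g3's p608879 `…N11PartCompatOfCouplings` (`partCompat₁₃_of_log_pow_le`, `log_pow_le_of_dCubeSide_le`, `room_of_dCubeSide_le`, `sitesPerDir_zero_eq`) and p611474
(`pow_add_ge_add`).

WHY THIS FILE.  p615408 stated the guard as a floor on the last coupling WITH SLACK (`log g_K⁻² ≤ L^{m−a}` necessary, `log(g_K⁻² + B) ≤ L^{m−a}` sufficient).  Reading the memo's addendum
(«the floor is print's p. 257 standing assumption at the top scale: the physical torus `2L^m` contains one top-scale 𝐃-cube `M·R_K(g_K)`») back into Lean removes the slack: under the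
window `]0, γ]`, the β-ceiling `B ≥ 0` along the run and the mild size letter `B·γ² ≤ 1` (every K1 window has `γ ≤ ½`), compatibility at the TOP level ALONE propagates down —
`log g_i⁻² ≤ log(g_K⁻² + B(K−i)) ≤ log g_K⁻² + B(K−i)g_K² ≤ L^{m−a} + (K−i) ≤ L^{m+K−i−a}` (log-log growth against the exponential room) — so `PartCompat₁₃ θ p K ⟺ L^K·M·R_K(g_K) ∣ 2L^{m+K}
⟺ M·R_K(g_K) ∣ 2L^m`.  For the plan: the faithful (β)-edit of the crux's window is EXACTLY print's clause «the top partition is compatible» = «`M·R_K(g_K)` divides the physical torus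
period», per run; on (0.20)-runs with bounded β nothing else is needed for the guard at all levels.  Count-neutral; nothing registered is denied.

WHAT THIS FILE PROVES (0 `sorry`, 0 `def`; elementary).  §1 `dCubeSide_dvd_iff_mul_dvd` (`L^K·M·R ∣ 2L^{m+K} ⟺ M·R ∣ 2L^m`).
§2 ★★★ `partCompat₁₃_of_topDvd_of_window_of_betaLe` (generic θ, `M = L^a`, `r = 1`) · `topDvd_of_partCompat₁₃` · ★★★ `partCompat₁₃_top_iff_topDvd` (`1 ≤ K`) · ★★
`partCompat₁₃_top_iff_mul_dvd_physicalTorus` (`⟺ M·R_K(g_K) ∣ 2L^m`).  §3 at θ₁₅ᶜᶜᴹᵂ(j; γ) (`a = j`, `r = 1`).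

HONEST FRAMING.  Helper lane of K1⁸; count-neutral ℕ∕ℝ bookkeeping; the β-ceiling and the window are HYPOTHESES; nothing of [I]∕[III] asserted; NOT a discharge.  N11 NOT discharged;
K1⁸ NOT closed; counts unmoved (typed 28∕28 · discharged 5∕27).  R4 closes only the conditional finite-𝕋⁴ rung `BalabanLadder.UV` of one programme at fixed `ε = L^{−K}` — NOT ℝ⁴, NOT OS,
NOT a mass gap, NOT Clay.  No `sorry`, `axiom`, `def`, `instance`, `notation`.  Sources (SHAPE ∕ bookkeeping only): [III] (2.1) p.254, (2.5) p.255, p.257; [I] (0.1) p.251, (0.20) p.256.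
-/

noncomputable section

namespace Summit.QuantumFields.YangMills.Theorems.BalabanUVNodesN11RunGuardIsTopCube

open Literature.MathematicalPhysics.QuantumFieldTheory.Balaban1983to89 T4Continuum Node00
open FlowStep (HBeta prefixOf)
open BalabanUVNodesN11PartCompatOfCouplings (partCompat₁₃_of_log_pow_le log_pow_le_of_dCubeSide_le room_of_dCubeSide_le sitesPerDir_zero_eq)
open BalabanUVNodesN11PartCompatOfTwoSidedRunning (pow_add_ge_add)
open BalabanUVNodesN11RunGuardIsCouplingFloor (inv_sq_genSeq_le_top_add_of_betaLe)

/-! ## §1  Arithmetic -/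

section Arith

/-- `L^K·M·R ∣ 2·L^{m+K} ⟺ M·R ∣ 2·L^m` (`L ≥ 1`): the top `𝐃_K`-cube fits the fine torus iff the cube `M·R_K` (in unit-lattice units) divides the PHYSICAL torus period `2L^m`.
[cite: Balaban1988Convergent, (2.1) p.254, p.257; Balaban1987RG1, (0.1) p.251] -/
theorem dCubeSide_dvd_iff_mul_dvd {L M R m K : ℕ} (hL : 1 ≤ L) : dCubeSide L M R K ∣ 2 * L ^ (m + K) ↔ M * R ∣ 2 * L ^ m := by
  have hpos : 0 < L ^ K := by positivity
  have h : 2 * L ^ (m + K) = L ^ K * (2 * L ^ m) := by rw [pow_add]; ring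
  rw [dCubeSide, h, mul_assoc]
  exact Nat.mul_dvd_mul_iff_left hpos

end Arith

/-! ## §2  Generic θ (`M = L^a`, `r = 1`): compatibility at the TOP propagates to every level on a windowed run with a β-ceiling -/

section Record

variable {F : T4Family} {N : ℕ} [NeZero N]

/-- **★★★ THE TOP CUBE FITS ⇒ THE GUARD AT EVERY LEVEL** (generic θ with `θ.τ9.M = F.L^a`, `θ.ν.r = 1`): if the record's run `p` lies in `]0, γ]` up to `K`, the record's β read
along it is `≤ B` (`0 ≤ B`, `B·γ² ≤ 1`), and the TOP `𝐃_K`-cube divides the torus period, then `PartCompat₁₃ θ p n` for every `n ≤ K` — the lower levels inherit compatibility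
because `log g_i⁻²` grows only log-log below the top while the room grows like `L^{K−i}`. [cite: Balaban1988Convergent, (2.1) p.254, (2.5) p.255, p.257; Balaban1987RG1, (0.20) p.256, (0.1) p.251] -/
theorem partCompat₁₃_of_topDvd_of_window_of_betaLe (θ : Stage13Params F N) {a : ℕ} (hM : θ.τ9.M = F.L ^ a) (hr : θ.ν.r = 1)
    (p : B12.RunParams) {γ B : ℝ} (hB0 : 0 ≤ B) (hBγ : B * γ ^ 2 ≤ 1)
    (hW : Step.InInterval γ p.K (gOfRecord₁₃ F N θ p))
    (hB : ∀ j, j < p.K → betaOfRecord₁₃ F N θ j (prefixOf (gOfRecord₁₃ F N θ p) j) ≤ B)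
    (htop : dCubeSide (F.P p.K).L θ.τ9.M (RkOfRecord (F.P p.K).L θ.ν.r (gOfRecord₁₃ F N θ p p.K)) p.K ∣ (F.P p.K).sitesPerDir 0)
    {n : ℕ} (hn : n ≤ p.K) : PartCompat₁₃ F N θ p n := by
  have hL3 : 3 ≤ F.L := by have := F.hL11; omega
  have hL2 : 2 ≤ F.L := by omega
  -- size of the top cube and the top floor
  have hsz : dCubeSide F.L θ.τ9.M (RkOfRecord F.L θ.ν.r (gOfRecord₁₃ F N θ p p.K)) p.K ≤ 2 * F.L ^ (F.m + p.K) := by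
    have h := Nat.le_of_dvd (Nat.pos_of_ne_zero ((F.P p.K).sitesPerDir_ne_zero 0)) htop
    rw [sitesPerDir_zero_eq] at h
    simpa only [T4Family.P_L] using h
  have hroom : p.K + a ≤ F.m + p.K := room_of_dCubeSide_le hL3 hM _ hsz
  have ha : a ≤ F.m := by omega
  have hflr := log_pow_le_of_dCubeSide_le hL3 hM _ hsz
  rw [hr, pow_one, show F.m + p.K - p.K - a = F.m - a by omega] at hflr
  -- the couplings
  obtain ⟨hgK, hgKγ⟩ := hW p.K le_rfl
  have hgK2 : 0 < gOfRecord₁₃ F N θ p p.K ^ 2 := by positivity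
  refine partCompat₁₃_of_log_pow_le θ hM p n (fun i => F.m + p.K - i - a) (fun i _ hi => by omega) fun i h1 hi => ?_
  rw [hr, pow_one]
  have hiK : i ≤ p.K := hi.trans hn
  obtain ⟨hgi, -⟩ := hW i hiK
  have hgi2 : 0 < gOfRecord₁₃ F N θ p i ^ 2 := by positivity
  -- upper running: `1∕g_i² ≤ 1∕g_K² + B·(K − i)`
  have hup := inv_sq_genSeq_le_top_add_of_betaLe hW hB hiK
  have hd0 : (0 : ℝ) ≤ B * ((p.K - i : ℕ) : ℝ) := by positivity
  have h1 : (gOfRecord₁₃ F N θ p i ^ 2)⁻¹ ≤ (gOfRecord₁₃ F N θ p p.K ^ 2)⁻¹ + B * ((p.K - i : ℕ) : ℝ) := by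
    rw [← one_div, ← one_div]; exact hup
  -- `log(y + c) ≤ log y + c∕y` (the tree's `Literature.NumberTheory.LFunctions.SchoenfeldBound.log_add_le`; two lines inlined here to keep the import closure inside N11)
  have hlogadd : ∀ {y c : ℝ}, 0 < y → 0 ≤ c → Real.log (y + c) ≤ Real.log y + c / y := by
    intro y c hy hc
    have e : y + c = y * (1 + c / y) := by field_simp
    rw [e, Real.log_mul hy.ne' (by positivity)]
    have := Real.log_le_sub_one_of_pos (show 0 < 1 + c / y by positivity)
    linarith
  have h2 : Real.log (gOfRecord₁₃ F N θ p i ^ 2)⁻¹ ≤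
      Real.log (gOfRecord₁₃ F N θ p p.K ^ 2)⁻¹ + B * ((p.K - i : ℕ) : ℝ) / (gOfRecord₁₃ F N θ p p.K ^ 2)⁻¹ :=
    (Real.log_le_log (by positivity) h1).trans (hlogadd (by positivity) hd0)
  -- `B(K−i)∕(g_K²)⁻¹ = B(K−i)·g_K² ≤ K − i`
  have h3 : B * ((p.K - i : ℕ) : ℝ) / (gOfRecord₁₃ F N θ p p.K ^ 2)⁻¹ ≤ ((p.K - i : ℕ) : ℝ) := by
    rw [div_inv_eq_mul]
    have hg2γ : gOfRecord₁₃ F N θ p p.K ^ 2 ≤ γ ^ 2 := by gcongr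
    have hd : (0 : ℝ) ≤ ((p.K - i : ℕ) : ℝ) := Nat.cast_nonneg _
    calc B * ((p.K - i : ℕ) : ℝ) * gOfRecord₁₃ F N θ p p.K ^ 2
        = (B * gOfRecord₁₃ F N θ p p.K ^ 2) * ((p.K - i : ℕ) : ℝ) := by ring
      _ ≤ (B * γ ^ 2) * ((p.K - i : ℕ) : ℝ) := by gcongr
      _ ≤ 1 * ((p.K - i : ℕ) : ℝ) := by gcongr
      _ = ((p.K - i : ℕ) : ℝ) := one_mul _
  have hexp : F.m + p.K - i - a = (F.m - a) + (p.K - i) := by omega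
  calc Real.log (gOfRecord₁₃ F N θ p i ^ 2)⁻¹
      ≤ ((F.L ^ (F.m - a) : ℕ) : ℝ) + ((p.K - i : ℕ) : ℝ) := by linarith
    _ ≤ ((F.L ^ (F.m - a) * F.L ^ (p.K - i) : ℕ) : ℝ) := pow_add_ge_add hL2 _ _
    _ = ((F.L ^ (F.m + p.K - i - a) : ℕ) : ℝ) := by rw [hexp, pow_add]

/-- Conversely, compatibility at the top level `K ≥ 1` contains the divisibility of the top cube (the definition). [cite: Balaban1988Convergent, p.257 (bookkeeping)] -/
theorem topDvd_of_partCompat₁₃ (θ : Stage13Params F N) (p : B12.RunParams) (hK : 1 ≤ p.K) (h : PartCompat₁₃ F N θ p p.K) :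
    dCubeSide (F.P p.K).L θ.τ9.M (RkOfRecord (F.P p.K).L θ.ν.r (gOfRecord₁₃ F N θ p p.K)) p.K ∣ (F.P p.K).sitesPerDir 0 :=
  h p.K hK le_rfl

/-- **★★★ AT FULL LENGTH THE GUARD IS «THE TOP CUBE FITS»** (generic θ, `M = L^a`, `r = 1`, window with `B·γ² ≤ 1` and β-ceiling, `K ≥ 1`):
`PartCompat₁₃ θ p K ⟺ L^K·M·R_K(g_K) ∣ 2L^{m+K}` — print's p. 257 standing assumption AT THE TOP SCALE, verbatim, and nothing more. [cite: Balaban1988Convergent, (2.1) p.254, (2.5) p.255, p.257; Balaban1987RG1, (0.1) p.251, (0.20) p.256] -/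
theorem partCompat₁₃_top_iff_topDvd (θ : Stage13Params F N) {a : ℕ} (hM : θ.τ9.M = F.L ^ a) (hr : θ.ν.r = 1)
    (p : B12.RunParams) (hK : 1 ≤ p.K) {γ B : ℝ} (hB0 : 0 ≤ B) (hBγ : B * γ ^ 2 ≤ 1)
    (hW : Step.InInterval γ p.K (gOfRecord₁₃ F N θ p))
    (hB : ∀ j, j < p.K → betaOfRecord₁₃ F N θ j (prefixOf (gOfRecord₁₃ F N θ p) j) ≤ B) :
    PartCompat₁₃ F N θ p p.K ↔
      dCubeSide (F.P p.K).L θ.τ9.M (RkOfRecord (F.P p.K).L θ.ν.r (gOfRecord₁₃ F N θ p p.K)) p.K ∣ (F.P p.K).sitesPerDir 0 :=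
  ⟨topDvd_of_partCompat₁₃ θ p hK, fun h => partCompat₁₃_of_topDvd_of_window_of_betaLe θ hM hr p hB0 hBγ hW hB h le_rfl⟩

/-- **★★ … EQUIVALENTLY: THE PHYSICAL TORUS CONTAINS ONE TOP-SCALE CUBE** — `PartCompat₁₃ θ p K ⟺ M·R_K(g_K) ∣ 2·L^m` (the unit lattice of the last step IS the physical torus of
side `2L^m`; [I] (0.1)). [cite: Balaban1988Convergent, (2.1) p.254, (2.5) p.255, p.257; Balaban1987RG1, (0.1) p.251] -/
theorem partCompat₁₃_top_iff_mul_dvd_physicalTorus (θ : Stage13Params F N) {a : ℕ} (hM : θ.τ9.M = F.L ^ a) (hr : θ.ν.r = 1)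
    (p : B12.RunParams) (hK : 1 ≤ p.K) {γ B : ℝ} (hB0 : 0 ≤ B) (hBγ : B * γ ^ 2 ≤ 1)
    (hW : Step.InInterval γ p.K (gOfRecord₁₃ F N θ p))
    (hB : ∀ j, j < p.K → betaOfRecord₁₃ F N θ j (prefixOf (gOfRecord₁₃ F N θ p) j) ≤ B) :
    PartCompat₁₃ F N θ p p.K ↔ θ.τ9.M * RkOfRecord F.L θ.ν.r (gOfRecord₁₃ F N θ p p.K) ∣ 2 * F.L ^ F.m := by
  rw [partCompat₁₃_top_iff_topDvd θ hM hr p hK hB0 hBγ hW hB, sitesPerDir_zero_eq]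
  simp only [T4Family.P_L]
  exact dCubeSide_dvd_iff_mul_dvd (by have := F.hL11; omega)

end Record

/-! ## §3  At K1's witness of record `θ₁₅ᶜᶜᴹᵂ(j; γ)` (`M = L^j`, `r = 1`) -/

section Witness

variable (F : T4Family) (N : ℕ) [NeZero N] (j : ℕ) (γ ε₀ ε₂₉ B₃ B₃' a₀ a₁ : ℝ)

/-- **★★ AT θ₁₅ᶜᶜᴹᵂ(j; γ): ON A WINDOWED RUN WITH A β-CEILING (`B·γ′² ≤ 1`), `PartCompat₁₃` AT FULL LENGTH ⟺ `L^j·R_K(g_K) ∣ 2L^m`** — the physical torus contains one top-scale 𝐃-cube.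
[cite: Balaban1988Convergent, (2.1) p.254, (2.5) p.255, p.257; Balaban1987RG1, (0.1) p.251; Balaban1989LargeFieldI, (2.1) p.182] -/
theorem partCompat₁₃_theta13OfThm1CCMW_top_iff_mul_dvd (p : B12.RunParams) (hK : 1 ≤ p.K) {γ' B : ℝ} (hB0 : 0 ≤ B) (hBγ : B * γ' ^ 2 ≤ 1)
    (hW : Step.InInterval γ' p.K (gOfRecord₁₃ F N (theta13OfThm1CCMW F N j γ ε₀ ε₂₉ B₃ B₃' a₀ a₁) p))
    (hB : ∀ i, i < p.K → betaOfRecord₁₃ F N (theta13OfThm1CCMW F N j γ ε₀ ε₂₉ B₃ B₃' a₀ a₁) i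
      (prefixOf (gOfRecord₁₃ F N (theta13OfThm1CCMW F N j γ ε₀ ε₂₉ B₃ B₃' a₀ a₁) p) i) ≤ B) :
    PartCompat₁₃ F N (theta13OfThm1CCMW F N j γ ε₀ ε₂₉ B₃ B₃' a₀ a₁) p p.K ↔
      F.L ^ j * RkOfRecord F.L 1 (gOfRecord₁₃ F N (theta13OfThm1CCMW F N j γ ε₀ ε₂₉ B₃ B₃' a₀ a₁) p p.K) ∣ 2 * F.L ^ F.m := by
  have h := partCompat₁₃_top_iff_mul_dvd_physicalTorus (theta13OfThm1CCMW F N j γ ε₀ ε₂₉ B₃ B₃' a₀ a₁)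
    (theta13OfThm1CCMW_τ9_M F N j γ ε₀ ε₂₉ B₃ B₃' a₀ a₁) (theta13OfThm1CCMW_r F N j γ ε₀ ε₂₉ B₃ B₃' a₀ a₁) p hK hB0 hBγ hW hB
  rw [theta13OfThm1CCMW_τ9_M, theta13OfThm1CCMW_r] at h
  exact h

end Witness

end Summit.QuantumFields.YangMills.Theorems.BalabanUVNodesN11RunGuardIsTopCube

end
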